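import Summits.Ventures.HSemireg.WedgeHankelRecurrenceCensusTotient
import Summits.Ventures.HSemireg.WedgeHankelRecurrenceCensusAnnihilated
import Summits.Ventures.HSemireg.WedgeHankelRecurrenceWaringDichotomy

/-!
# Venture HSemireg — THE WARING CENSUS: over a field with `s` elements and for `2r ≤ N + 1`, **exactly `C(s, r)·(s − 1)^r` classes on `[0, N]` are honest sums of `r` geometric sequences,
# `q_j = Σ_{i<r} A_i λ_i^j` with `r` distinct nodes `λ_i ∈ K` and non-zero weights** (out of the `(s² − 1)·s^{2r−2}` classes of middle rank `r`, N44): they are the classes of rank `r` whose minimal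
# recurrence is `∏_{λ ∈ S} (X − λ)` for an `r`-subset `S ⊆ K`, and each such fibre has `φ(∏_S (X − λ)) = (s − 1)^r` classes (N53/N54)

HONEST FRAMING. Part of the Lean index of the computation cell `pub-hsemireg` (seat p10 gen 29, Sunday typer «UNIFORM-IN-n»).
LINEAR ALGEBRA OF HANKEL (catalecticant) MATRICES and of polynomials over a field ONLY: no variety, no cohomology theory, no sheaf, no Ext group and no semiregularity map is constructed
here; nothing here says that HC / HC_CM / HC_AV holds; no Literature fact is declared or used.  Custodian versions as in `WedgeHankelSiegelIdeal` (1/3); the dictionary («binary forms of degree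
`N` over `F_s` of Waring rank `r` with all nodes rational and finite») is QUOTED, never asserted.

WHAT IS IN THE TREE / CHAINED.  N53 (№ 371) `ncard_setOf_rank_eq_and_mem_recSpace` (the fibre over `m` has `φ(m)` classes); N54 (№ 377) `ncard_unitResidues_prod_X_sub_C` (`φ(∏ (X − λᵢ)) = (s−1)^{#}`);
N57 (№ 383) `eq_of_monic_of_rank_eq_of_mem_recSpace` (the monic minimal recurrence is unique); N61 (№ 391) `prod_X_sub_C_mem_recSpace_of_secSeq_agree`, `rank_le_of_secSeq_agree`; N23 (№ 176)
`exists_secSeq_of_prod_X_sub_C_mem_recSpace`; N19 (№ 174) `rank_hankel1_half_secSeq`; N44 (№ 326) `seqOf`, `seqOf_apply_of_lt`.  Mathlib: `Finset.card_eq_sum_card_fiberwise`, `Finset.card_powersetCard`,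
`Polynomial.roots_prod_X_sub_C`, `Polynomial.monic_prod_X_sub_C`, `Polynomial.natDegree_prod_of_monic`, `Finset.prod_image`, `Finset.equivFin`.
THIS FILE (namespace `Summit.Ventures.HSemireg.Wedge.HankelOuter` continued; CHAINED on N61 (N54, N57 in the tree); 0 definitions):
* §604 `natDegree_prod_X_sub_C_finset`, `eq_of_prod_X_sub_C_eq` (the node set is read off the product), **`ncard_setOf_rank_eq_and_prod_mem_recSpace`** (`#S = r`, `2r ≤ N + 1`: `(s − 1)^r` classes of
  rank `r` have minimal recurrence `∏_{λ∈S}(X − λ)`).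
* §605 **`sum_ncard_setOf_rank_eq_and_prod_mem_recSpace`** (summing over the `r`-subsets `S ⊆ K`: `#{v | R^N = r ∧ ∃ S, #S = r ∧ ∏_S ∈ Rec_r} = C(s, r)·(s − 1)^r`).
* §606 THE WARING READING: **`exists_secSeq_iff_exists_finset`** (for any class: an `r`-term representation with distinct nodes in `K` and non-zero weights on `[0, N]` ⟺ `R^N = r` and a split
  separable minimal recurrence `∏_S (X − λ)`), **`ncard_setOf_exists_secSeq`** (THE WARING CENSUS `C(s, r)·(s − 1)^r`).
Nothing Ext-side.  New names only.
-/

open Module Polynomial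
open scoped Matrix Polynomial

namespace Summit.Ventures.HSemireg.Wedge.HankelOuter

open Summit.Ventures.HSemireg.Wedge Summit.Ventures.HSemireg.Wedge.Hankel Summit.Ventures.HSemireg.Wedge.HankelSecant

variable (K : Type*) [Field K] {N : ℕ}

/-! ## §604. The fibre over a split separable minimal recurrence -/

/-- `deg ∏_{λ∈S} (X − λ) = #S`. -/
theorem natDegree_prod_X_sub_C_finset (S : Finset K) : (∏ x ∈ S, (Polynomial.X - Polynomial.C x)).natDegree = S.card := by
  rw [Polynomial.natDegree_prod_of_monic _ _ fun x _ => Polynomial.monic_X_sub_C x]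
  simp only [Polynomial.natDegree_X_sub_C, Finset.sum_const, smul_eq_mul, mul_one]

/-- the node set is determined by the product: `∏_S (X − λ) = ∏_{S′} (X − λ) ⇒ S = S′` (roots). -/
theorem eq_of_prod_X_sub_C_eq {S S' : Finset K} (h : (∏ x ∈ S, (Polynomial.X - Polynomial.C x)) = ∏ x ∈ S', (Polynomial.X - Polynomial.C x)) : S = S' := by
  have hr := congrArg Polynomial.roots h
  rw [Polynomial.roots_prod_X_sub_C, Polynomial.roots_prod_X_sub_C] at hr
  exact Finset.val_inj.mp hr

/-- **`(s − 1)^r` CLASSES OF RANK `r` HAVE MINIMAL RECURRENCE `∏_{λ∈S} (X − λ)` for every `r`-subset `S ⊆ K`** (`2r ≤ N + 1`; N53's fibre + N54's `φ`). -/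
theorem ncard_setOf_rank_eq_and_prod_mem_recSpace [Finite K] {r : ℕ} (S : Finset K) (hS : S.card = r) (h2 : r + r ≤ N + 1) :
    {v : Fin (N + 1) → K | (hankel1 K N (N / 2) (seqOf K v)).rank = r ∧ (∏ x ∈ S, (Polynomial.X - Polynomial.C x)) ∈ recSpace K N (seqOf K v) r}.ncard = (Nat.card K - 1) ^ r := by
  have hdeg := natDegree_prod_X_sub_C_finset K S
  rw [hS] at hdeg
  have h := ncard_setOf_rank_eq_and_mem_recSpace K (N := N) (Polynomial.monic_prod_X_sub_C (fun x : K => x) S) (by rw [hdeg]; exact h2)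
  rw [hdeg] at h
  rw [h, ncard_unitResidues_prod_X_sub_C K S (fun x : K => x) (Set.injOn_id _), hS]

/-! ## §605. Summing over the `r`-subsets of `K` -/

/-- **`#{v | R^N(v) = r ∧ ∃ S ⊆ K, #S = r, ∏_S (X − λ) ∈ Rec_r(v)} = C(s, r)·(s − 1)^r`** (`2r ≤ N + 1`; fiberwise over the node set, which is determined by the class — N57's uniqueness of the monic
minimal recurrence and the roots of the product). -/
theorem sum_ncard_setOf_rank_eq_and_prod_mem_recSpace [Finite K] {r : ℕ} (h2 : r + r ≤ N + 1) :
    {v : Fin (N + 1) → K | (hankel1 K N (N / 2) (seqOf K v)).rank = r ∧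
        ∃ S : Finset K, S.card = r ∧ (∏ x ∈ S, (Polynomial.X - Polynomial.C x)) ∈ recSpace K N (seqOf K v) r}.ncard = (Nat.card K).choose r * (Nat.card K - 1) ^ r := by
  classical
  haveI := Fintype.ofFinite K
  -- the node set as a function
  let f : (Fin (N + 1) → K) → Finset K := fun v =>
    if h : ∃ S : Finset K, S.card = r ∧ (∏ x ∈ S, (Polynomial.X - Polynomial.C x)) ∈ recSpace K N (seqOf K v) r then Classical.choose h else ∅
  let P : (Fin (N + 1) → K) → Prop := fun v => (hankel1 K N (N / 2) (seqOf K v)).rank = r ∧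
    ∃ S : Finset K, S.card = r ∧ (∏ x ∈ S, (Polynomial.X - Polynomial.C x)) ∈ recSpace K N (seqOf K v) r
  have hf : ∀ v, P v → (f v).card = r ∧ (∏ x ∈ f v, (Polynomial.X - Polynomial.C x)) ∈ recSpace K N (seqOf K v) r := fun v hv => by
    simp only [f, dif_pos hv.2]
    exact Classical.choose_spec hv.2
  -- uniqueness of the node set
  have huniq : ∀ v, P v → ∀ S : Finset K, S.card = r → (∏ x ∈ S, (Polynomial.X - Polynomial.C x)) ∈ recSpace K N (seqOf K v) r → S = f v := fun v hv S hS hSm => by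
    obtain ⟨hfc, hfm⟩ := hf v hv
    refine eq_of_prod_X_sub_C_eq K (eq_of_monic_of_rank_eq_of_mem_recSpace K (Polynomial.monic_prod_X_sub_C (fun x : K => x) S) (Polynomial.monic_prod_X_sub_C (fun x : K => x) (f v))
      (by rw [natDegree_prod_X_sub_C_finset, hS]; exact hv.1) (by rw [natDegree_prod_X_sub_C_finset, hfc]; exact hv.1) (by rw [natDegree_prod_X_sub_C_finset, hS]; exact h2) ?_ ?_)
    · rw [natDegree_prod_X_sub_C_finset, hS]; exact hSm
    · rw [natDegree_prod_X_sub_C_finset, hfc]; exact hfm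
  have hmaps : ((Finset.univ.filter P : Finset (Fin (N + 1) → K)) : Set (Fin (N + 1) → K)).MapsTo f (Finset.powersetCard r (Finset.univ : Finset K)) := fun v hv => by
    have hv' : P v := (Finset.mem_filter.mp (Finset.mem_coe.mp hv)).2
    exact Finset.mem_coe.mpr (Finset.mem_powersetCard.mpr ⟨Finset.subset_univ _, (hf v hv').1⟩)
  have h := Finset.card_eq_sum_card_fiberwise hmaps
  have hlhs : {v : Fin (N + 1) → K | P v}.ncard = (Finset.univ.filter P).card := by rw [← Finset.coe_filter_univ, Set.ncard_coe_finset]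
  rw [show {v : Fin (N + 1) → K | (hankel1 K N (N / 2) (seqOf K v)).rank = r ∧ ∃ S : Finset K, S.card = r ∧ (∏ x ∈ S, (Polynomial.X - Polynomial.C x)) ∈ recSpace K N (seqOf K v) r}
      = {v | P v} from rfl, hlhs, h]
  have hfib : ∀ S ∈ Finset.powersetCard r (Finset.univ : Finset K), ((Finset.univ.filter P).filter fun v => f v = S).card = (Nat.card K - 1) ^ r := fun S hS => by
    have hSc : S.card = r := (Finset.mem_powersetCard.mp hS).2
    rw [← ncard_setOf_rank_eq_and_prod_mem_recSpace K S hSc h2, ← Set.ncard_coe_finset, Finset.coe_filter]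
    refine congrArg Set.ncard (Set.ext fun v => ?_)
    simp only [Set.mem_setOf_eq, Finset.mem_filter, Finset.mem_univ, true_and]
    constructor
    · rintro ⟨hv, hfv⟩
      obtain ⟨hfc, hfm⟩ := hf v hv
      rw [hfv] at hfm
      exact ⟨hv.1, hfm⟩
    · rintro ⟨hR, hmem⟩
      have hv : P v := ⟨hR, S, hSc, hmem⟩
      exact ⟨hv, (huniq v hv S hSc hmem).symm⟩
  rw [Finset.sum_congr rfl hfib, Finset.sum_const, smul_eq_mul, Finset.card_powersetCard, Finset.card_univ, ← Nat.card_eq_fintype_card]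

/-! ## §606. The Waring reading and the census -/

/-- **AN HONEST `r`-TERM REPRESENTATION ⟺ RANK `r` WITH A SPLIT SEPARABLE MINIMAL RECURRENCE: for `2r ≤ N + 1` and any `q`, `q_j = Σ_{i<r} A_i λ_i^j` on `[0, N]` with distinct `λ_i ∈ K` and all
`A_i ≠ 0` ⟺ `R^N(q) = r` and `∏_{λ∈S}(X − λ) ∈ Rec_r(q)` for some `r`-subset `S ⊆ K`** (N19/N23; the weights are non-zero because fewer terms would drop the rank, N61). -/
theorem exists_secSeq_iff_exists_finset {r : ℕ} (h2 : r + r ≤ N + 1) (q : ℕ → K) :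
    (∃ (lam A : Fin r → K), Function.Injective lam ∧ (∀ i, A i ≠ 0) ∧ ∀ j ≤ N, q j = secSeq K A lam j)
      ↔ (hankel1 K N (N / 2) q).rank = r ∧ ∃ S : Finset K, S.card = r ∧ (∏ x ∈ S, (Polynomial.X - Polynomial.C x)) ∈ recSpace K N q r := by
  classical
  constructor
  · rintro ⟨lam, A, hlam, hA, hrep⟩
    refine ⟨?_, Finset.univ.image lam, ?_, ?_⟩
    · rw [rank_hankel1_half_congr K hrep]; exact rank_hankel1_half_secSeq K hA hlam h2
    · rw [Finset.card_image_of_injective _ hlam, Finset.card_univ, Fintype.card_fin]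
    · rw [Finset.prod_image fun i _ j _ h => hlam h]
      exact prod_X_sub_C_mem_recSpace_of_secSeq_agree K hlam hrep
  · rintro ⟨hR, S, hS, hmem⟩
    -- enumerate the node set
    let e := S.equivFin.trans (finCongr hS)
    let lam : Fin r → K := fun i => (e.symm i : K)
    have hlam : Function.Injective lam := fun i j h => e.symm.injective (Subtype.ext h)
    have hprod : (∏ i, (Polynomial.X - Polynomial.C (lam i))) = ∏ x ∈ S, (Polynomial.X - Polynomial.C x) := by
      rw [← Finset.prod_coe_sort S]
      exact Fintype.prod_equiv e.symm (fun i => Polynomial.X - Polynomial.C (lam i)) (fun x => Polynomial.X - Polynomial.C (x : K)) fun i => rfl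
    have hmem' : (∏ i, (Polynomial.X - Polynomial.C (lam i))) ∈ recSpace K N q r := by rw [hprod]; exact hmem
    obtain ⟨A, hA⟩ := exists_secSeq_of_prod_X_sub_C_mem_recSpace K hlam hmem'
    refine ⟨lam, A, hlam, fun i hAi => ?_, hA⟩
    -- a vanishing weight: the product over the OTHER nodes is already a recurrence of window `r`, contradicting `R^N(q) = r`
    set p : K[X] := ∏ k ∈ Finset.univ.erase i, (Polynomial.X - Polynomial.C (lam k)) with hp
    have hpdeg : p.natDegree = r - 1 := by
      rw [hp, Polynomial.natDegree_prod_of_monic _ _ fun k _ => Polynomial.monic_X_sub_C (lam k)]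
      simp only [Polynomial.natDegree_X_sub_C, Finset.sum_const, smul_eq_mul, mul_one, Finset.card_erase_of_mem (Finset.mem_univ i), Finset.card_univ, Fintype.card_fin]
    have hp0 : p ≠ 0 := (Polynomial.monic_prod_of_monic _ _ fun k _ => Polynomial.monic_X_sub_C (lam k)).ne_zero
    have hpmem : p ∈ recSpace K N q (r - 1) := by
      rw [recSpace_congr K hA]
      refine (mem_recSpace_iff K).mpr ⟨(mem_degreeLT_succ_iff K).mpr hpdeg.le, fun s _ => ?_⟩
      rw [hkFun_secSeq]
      refine Finset.sum_eq_zero fun k _ => ?_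
      rcases eq_or_ne k i with rfl | hki
      · rw [hAi, zero_mul, zero_mul]
      · rw [hp, Polynomial.eval_prod, Finset.prod_eq_zero (Finset.mem_erase.mpr ⟨hki, Finset.mem_univ k⟩) (by rw [Polynomial.eval_sub, Polynomial.eval_X, Polynomial.eval_C, sub_self]),
          mul_zero]
    have hbot := recSpace_eq_bot_of_lt K hR (show r - 1 < r by have := i.2; omega)
    rw [hbot, Submodule.mem_bot] at hpmem
    exact hp0 hpmem

/-- **THE WARING CENSUS: over a field with `s` elements and for `2r ≤ N + 1`, exactly `C(s, r)·(s − 1)^r` classes `v` on `[0, N]` are sums of `r` geometric sequences with `r` distinct nodes in `K`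
and non-zero weights** (out of `(s² − 1)·s^{2r−2}` classes of middle rank `r`, N44). -/
theorem ncard_setOf_exists_secSeq [Finite K] {r : ℕ} (h2 : r + r ≤ N + 1) :
    {v : Fin (N + 1) → K | ∃ (lam A : Fin r → K), Function.Injective lam ∧ (∀ i, A i ≠ 0) ∧ ∀ j ≤ N, seqOf K v j = secSeq K A lam j}.ncard = (Nat.card K).choose r * (Nat.card K - 1) ^ r := by
  rw [← sum_ncard_setOf_rank_eq_and_prod_mem_recSpace K h2]
  exact congrArg Set.ncard (Set.ext fun v => exists_secSeq_iff_exists_finset K h2 (seqOf K v))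

end Summit.Ventures.HSemireg.Wedge.HankelOuter
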